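import Summits.KontsevichZagierPeriods.KontsevichZagierPeriods.Theorems.TerasomaMultiplicationMultiplicationAccessibleSieve
import Summits.KontsevichZagierPeriods.KontsevichZagierPeriods.Theorems.TerasomaMultiplicationMultiplicationThree
import Literature.NumberTheory.Transcendental.KZGaussMultiplicationChain
import Literature.NumberTheory.Transcendental.KZBetaChains

/-!
# `MultiplicationAccessible` (stmt-KontsevichZagierPeriods-12305), line `shifted-family-prime-sieve`:
the DOUBLING STEP, and Gauss multiplication inside the Kontsevich–Zagier rules at every `n = 3·2^k`

The crux (route TerasomaMultiplication, rank 3): for `m ≥ 1` (`n = m + 1`) and rational `s > 0` the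
box representation `[(0,1)^m, ∏ᵢ xᵢ^((i+1)/n − 1)(1 − xᵢ)^(s−1)]` of `∏_(k=1)^m B(k/n, s)` and the big
simplex representation `[{σ > 0, Σσ < n}, (∏σⱼ·(n − Σσⱼ))^(s−1)]` of `n^(ns−1)Γ(s)^n/Γ(ns)` are
equivalent under the moves of Kontsevich–Zagier (2001, §1.2); `Negative.At m s` is its instance.

This file proves, sorry-free and with no named fact, the **doubling step**
`At m (2s) → At (2m+1) s` (`at_doubling`: the instance at `n` and exponent `2s` gives the instance
at `2n` and exponent `s`) and hence, from the landed crux `MultiplicationThree` (= `At 2 s`,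
`Theorems/TerasomaMultiplicationMultiplicationThree.lean`), the crux instance at every `m` with
`m + 1 = 3·2^k` and every rational `s > 0` (`multiplicationAccessible_at_three_mul_two_pow`: the
Gauss multiplications at `n = 6, 12, 24, …` inside the calculus are new; `n = 3` is crux 2 of the
route, `n = 2^k` is `multiplicationAccessible_at_two_pow` of the Sieve).

Everything is a computation in the formal period ring `P = KZ.FormalPeriodRing` with the Beta
classes `g(p,q) = ⟦β(p,q)⟧` of a pinned Beta family (`MultGlue.exists_betaFamily`):
* `at_iff_prod_eq` — the instance `At m s` IS the identity
  `∏_(i<m) g((i+1)/(m+1), s) = ⟦[pt, (m+1)^((m+1)s−1)]⟧ ∏_(j<m) g(s, (j+1)s)` in `P`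
  (`KZ.gaussMultiplication_toFormalPeriod` and, conversely, `KZ.cubeBetaRep_toFormalPeriod_eq_prod` +
  `KZ.bigSimplex_toFormalPeriod` + `KZ.toFormalPeriod_eq_iff`);
* `dup_eq` — Legendre duplication for all exponents in `P`, `g(x,s)g(x+½,s) = ⟦4^s⟧ g(2x,2s)g(s,s)`
  (the Sieve's `gm_one`, through `GlueFromParts.exists_of_forall` and `MultGlue.gm_eq`);
* pairing `k ↔ k + n` in `∏_(k=1)^(2n−1) g(k/(2n), s)`, duplication on each pair, the instance at
  `(m, 2s)` on `∏_(k<n) g(k/n, 2s)`, the instance `n = 2` on the middle factor `g(½, s)`, and the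
  caterpillar `g(s,s)^(m+1) ∏_(j<m) g(2s, 2(j+1)s) = ∏_(j<2m+1) g(s, (j+1)s)` (`m` Dirichlet
  re-associations, `MultGlue.reassoc_eq` from the landed `stub_betaReassoc`).
References: Kontsevich–Zagier 2001 §1.2; Andrews–Askey–Roy 1999, Thm 1.5.1 (Legendre), 1.5.2 (Gauss),
1.8.1 (Dirichlet).
-/

noncomputable section

open MeasureTheory Set Finset
open scoped BigOperators
open Literature.NumberTheory.Transcendental
open Literature.NumberTheory.Transcendental.KZ
open Summit.KontsevichZagierPeriods.MultiplicationAccessible.Negative (boxDom At multiplicationAccessible_iff)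
open Summit.KontsevichZagierPeriods.KontsevichZagierPeriods.Theses.TerasomaMultiplication
  (MultiplicationThree)

namespace Summit.KontsevichZagierPeriods.TerasomaMultiplication.MultiplicationAccessible

namespace Doubling

/-! ## Beta classes of a pinned Beta family in `P` -/

/-- **Reflection in `P`**: `g(p,q) = g(q,p)` (one change of variables `t ↦ 1 − t`,
`KZ.betaReflection_equivalent`). [cite: KontsevichZagier2001, §1.2 rule (2)] -/
theorem refl_eq {B : ℚ → ℚ → IntegralRep 1}
    (hB : ∀ p q, 0 < p → 0 < q → (B p q).domain = {t | t 0 ∈ Set.Ioo (0:ℝ) 1} ∧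
      (B p q).integrand = fun t => (t 0) ^ ((p:ℝ) - 1) * (1 - t 0) ^ ((q:ℝ) - 1))
    {p q : ℚ} (hp : 0 < p) (hq : 0 < q) :
    toFormalPeriod (of (B p q)) = toFormalPeriod (of (B q p)) :=
  (betaReflection_equivalent ((p:ℝ) - 1) ((q:ℝ) - 1) (B p q) (B q p) (hB p q hp hq).1
    (by rw [(hB p q hp hq).2]; exact fun _ _ => rfl) (hB q p hq hp).1
    (by rw [(hB q p hq hp).2]; exact fun _ _ => rfl)).toFormalPeriod_eq

/-- **The crux instance `At m s` as an identity in `P`**: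
`∏_(i<m) g((i+1)/(m+1), s) = ⟦[pt, (m+1)^((m+1)s−1)]⟧ · ∏_(j<m) g(s, (j+1)s)`
(`→`: `KZ.gaussMultiplication_toFormalPeriod`; `←`: a box representation has formal period
`∏ g((i+1)/(m+1), s)` (`KZ.cubeBetaRep_toFormalPeriod_eq_prod`), a simplex representation has
formal period `⟦[pt, κ]⟧ ∏ g(s, (j+1)s)` (`KZ.bigSimplex_toFormalPeriod`), and equal formal periods
mean equivalence (`KZ.toFormalPeriod_eq_iff`)). [cite: AndrewsAskeyRoy1999, Thm 1.5.2] -/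
theorem at_iff_prod_eq {B : ℚ → ℚ → IntegralRep 1}
    (hB : ∀ p q, 0 < p → 0 < q → (B p q).domain = {t | t 0 ∈ Set.Ioo (0:ℝ) 1} ∧
      (B p q).integrand = fun t => (t 0) ^ ((p:ℝ) - 1) * (1 - t 0) ^ ((q:ℝ) - 1))
    (m : ℕ) (s : ℚ) (hs : 0 < s) :
    At m s ↔ ∏ i : Fin m, toFormalPeriod (of (B ((((i:ℕ):ℚ) + 1) / ((m:ℚ) + 1)) s)) =
      toFormalPeriod (of (IntegralRep.unit.constMul (((m:ℝ) + 1) ^ (((m:ℝ) + 1) * s - 1))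
        (isAlgebraic_gaussMultConst m s))) *
        ∏ j : Fin m, toFormalPeriod (of (B s ((((j:ℕ):ℚ) + 1) * s))) := by
  -- the pinned Beta representations on both sides
  set x : Fin m → ℚ := fun i => (((i:ℕ):ℚ) + 1) / ((m:ℚ) + 1) with hxdef
  set b : Fin m → ℚ := fun j => (((j:ℕ):ℚ) + 1) * s with hbdef
  have hxpos : ∀ i, 0 < x i := fun i => by positivity
  have hbpos : ∀ j, 0 < b j := fun j => by positivity
  have hβLd : ∀ i, (B (x i) s).domain = {t | t 0 ∈ Set.Ioo (0:ℝ) 1} :=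
    fun i => (hB _ _ (hxpos i) hs).1
  have hβLi : ∀ i, Set.EqOn (B (x i) s).integrand
      (fun t => (t 0) ^ (((x i : ℚ) : ℝ) - 1) * (1 - t 0) ^ ((s:ℝ) - 1)) (B (x i) s).domain :=
    fun i => by rw [(hB _ _ (hxpos i) hs).2]; exact fun _ _ => rfl
  have hβRd : ∀ j, (B s (b j)).domain = {t | t 0 ∈ Set.Ioo (0:ℝ) 1} :=
    fun j => (hB _ _ hs (hbpos j)).1
  have hβRi : ∀ j, Set.EqOn (B s (b j)).integrand
      (fun t => (t 0) ^ ((s:ℝ) - 1) * (1 - t 0) ^ (((b j : ℚ) : ℝ) - 1)) (B s (b j)).domain :=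
    fun j => by rw [(hB _ _ hs (hbpos j)).2]; exact fun _ _ => rfl
  constructor
  · intro h
    exact gaussMultiplication_toFormalPeriod m s hs (fun r r' hd hi hd' hi' => h r r' ⟨hd, hi⟩
      ⟨hd', hi'⟩) x (fun i => rfl) (fun i => B (x i) s) hβLd hβLi b (fun j => rfl)
      (fun j => B s (b j)) hβRd hβRi (isAlgebraic_gaussMultConst m s)
  · intro h r r' hr hr'
    have hxR : ∀ i : Fin m, ((x i : ℚ) : ℝ) = (((i:ℕ):ℝ) + 1) / ((m:ℝ) + 1) := fun i => by
      simp only [hxdef]; push_cast; ring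
    have hpos : ∀ i : Fin m, 0 < x i ∧ 0 < s := fun i => ⟨hxpos i, hs⟩
    have hri : Set.EqOn r.integrand (fun t => ∏ i : Fin m,
        (t i) ^ (((x i : ℚ) : ℝ) - 1) * (1 - t i) ^ ((((fun _ => s) i : ℚ) : ℝ) - 1)) r.domain := by
      intro t ht
      rw [hr.2 ht]
      exact Finset.prod_congr rfl fun i _ => by rw [hxR]
    have h1 := cubeBetaRep_toFormalPeriod_eq_prod x (fun _ => s) hpos r (fun i => B (x i) s) hr.1
      hri hβLd hβLi
    have h2 := bigSimplex_toFormalPeriod m s hs r' hr'.1 hr'.2 b (fun j => rfl) (fun j => B s (b j))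
      hβRd hβRi (isAlgebraic_gaussMultConst m s)
    exact toFormalPeriod_eq_iff.mp (h1.trans (h.trans h2.symm))

/-- The same identity with the products indexed by `Finset.range m`. [folklore] -/
theorem at_iff_prod_range_eq {B : ℚ → ℚ → IntegralRep 1}
    (hB : ∀ p q, 0 < p → 0 < q → (B p q).domain = {t | t 0 ∈ Set.Ioo (0:ℝ) 1} ∧
      (B p q).integrand = fun t => (t 0) ^ ((p:ℝ) - 1) * (1 - t 0) ^ ((q:ℝ) - 1))
    (m : ℕ) (s : ℚ) (hs : 0 < s) :
    At m s ↔ ∏ i ∈ range m, toFormalPeriod (of (B (((i:ℚ) + 1) / ((m:ℚ) + 1)) s)) =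
      toFormalPeriod (of (IntegralRep.unit.constMul (((m:ℝ) + 1) ^ (((m:ℝ) + 1) * s - 1))
        (isAlgebraic_gaussMultConst m s))) *
        ∏ j ∈ range m, toFormalPeriod (of (B s (((j:ℚ) + 1) * s))) := by
  rw [at_iff_prod_eq hB m s hs,
    ← Fin.prod_univ_eq_prod_range (fun i => toFormalPeriod (of (B (((i:ℚ) + 1) / ((m:ℚ) + 1)) s))) m,
    ← Fin.prod_univ_eq_prod_range (fun j => toFormalPeriod (of (B s (((j:ℚ) + 1) * s)))) m]


/-- **Legendre duplication for all exponents in `P`**: `g(x,s) g(x+½,s) = ⟦[pt, 2^(2s)]⟧ g(2x,2s) g(s,s)`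
for rational `x, s > 0` — the Sieve's `gm_one` (ONE change of variables along the bijection `Φ` of
the open box after a symmetrised Kummer pull-back) read in `P` through
`GlueFromParts.exists_of_forall` and `MultGlue.gm_eq`. [cite: AndrewsAskeyRoy1999, Thm 1.5.1] -/
theorem dup_eq {B : ℚ → ℚ → IntegralRep 1}
    (hB : ∀ p q, 0 < p → 0 < q → (B p q).domain = {t | t 0 ∈ Set.Ioo (0:ℝ) 1} ∧
      (B p q).integrand = fun t => (t 0) ^ ((p:ℝ) - 1) * (1 - t 0) ^ ((q:ℝ) - 1))
    {x s : ℚ} (hx : 0 < x) (hs : 0 < s) :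
    toFormalPeriod (of (B x s)) * toFormalPeriod (of (B (x + 1 / 2) s)) =
      toFormalPeriod (of (IntegralRep.unit.constMul ((((1:ℕ):ℝ) + 1) ^ ((((1:ℕ):ℝ) + 1) * (s:ℝ)))
        (MultGlue.isAlgebraic_gaussConst 1 s))) *
        (toFormalPeriod (of (B (2 * x) (2 * s))) * toFormalPeriod (of (B s s))) := by
  have h := MultGlue.gm_eq hB (a := 1)
    (fun x s hx hs => GlueFromParts.exists_of_forall 1 x s hx hs (gm_one x s hx hs)) hx hs
  rw [Fin.prod_univ_two, Fin.prod_univ_one] at h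
  simp only [Fin.val_zero, Fin.val_one, Nat.cast_zero, (Nat.cast_one : ((1:ℕ):ℚ) = 1), zero_div,
    add_zero, zero_add, one_mul, one_add_one_eq_two] at h
  exact h

/-- **The instance `n = 2` in `P`**: `g(½, s) = ⟦[pt, 2^(2s−1)]⟧ g(s, s)` — the crux at `m = 1`
(the Sieve's `multiplicationAccessible_at_two_pow` at `k = 1`) read through `at_iff_prod_range_eq`.
[cite: AndrewsAskeyRoy1999, Thm 1.5.1] -/
theorem half_eq {B : ℚ → ℚ → IntegralRep 1}
    (hB : ∀ p q, 0 < p → 0 < q → (B p q).domain = {t | t 0 ∈ Set.Ioo (0:ℝ) 1} ∧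
      (B p q).integrand = fun t => (t 0) ^ ((p:ℝ) - 1) * (1 - t 0) ^ ((q:ℝ) - 1))
    {s : ℚ} (hs : 0 < s) :
    toFormalPeriod (of (B (1 / 2) s)) =
      toFormalPeriod (of (IntegralRep.unit.constMul ((((1:ℕ):ℝ) + 1) ^ ((((1:ℕ):ℝ) + 1) * s - 1))
        (isAlgebraic_gaussMultConst 1 s))) * toFormalPeriod (of (B s s)) := by
  have hAt : At 1 s := fun r r' hr hr' =>
    multiplicationAccessible_at_two_pow 1 1 (by norm_num) le_rfl s hs r r' hr.1 hr.2 hr'.1 hr'.2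
  have h := (at_iff_prod_range_eq hB 1 s hs).mp hAt
  simp only [prod_range_one, (Nat.cast_zero : ((0:ℕ):ℚ) = 0), (Nat.cast_one : ((1:ℕ):ℚ) = 1),
    zero_add, one_mul, one_add_one_eq_two] at h
  exact h

/-- **The caterpillar**: `g(s,s)^(m+1) ∏_(j<m) g(2s, 2(j+1)s) = ∏_(j<2m+1) g(s, (j+1)s)` in `P` —
`m` Dirichlet re-associations `g(s,s) g(2s, (2j+2)s) = g(s, (2j+2)s) g(s, (2j+3)s)`
(`MultGlue.reassoc_eq` from the landed `stub_betaReassoc`). Value identity: both sides are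
`Γ(s)^(2m+2)/Γ((2m+2)s)`. [cite: AndrewsAskeyRoy1999, Thm 1.8.1] -/
theorem caterpillar_eq {B : ℚ → ℚ → IntegralRep 1}
    (hB : ∀ p q, 0 < p → 0 < q → (B p q).domain = {t | t 0 ∈ Set.Ioo (0:ℝ) 1} ∧
      (B p q).integrand = fun t => (t 0) ^ ((p:ℝ) - 1) * (1 - t 0) ^ ((q:ℝ) - 1))
    {s : ℚ} (hs : 0 < s) : ∀ m : ℕ,
    toFormalPeriod (of (B s s)) ^ (m + 1) *
        ∏ j ∈ range m, toFormalPeriod (of (B (2 * s) (((j:ℚ) + 1) * (2 * s)))) =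
      ∏ j ∈ range (2 * m + 1), toFormalPeriod (of (B s (((j:ℚ) + 1) * s)))
  | 0 => by
    rw [zero_add, pow_one, prod_range_zero, mul_one, Nat.mul_zero, zero_add, prod_range_one,
      Nat.cast_zero, zero_add, one_mul]
  | m + 1 => by
    rw [show 2 * (m + 1) + 1 = 2 * m + 1 + 1 + 1 by ring,
      prod_range_succ (fun j => toFormalPeriod (of (B s (((j:ℚ) + 1) * s)))) (2 * m + 1 + 1),
      prod_range_succ (fun j => toFormalPeriod (of (B s (((j:ℚ) + 1) * s)))) (2 * m + 1),
      ← caterpillar_eq hB hs m, pow_succ,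
      prod_range_succ (fun j => toFormalPeriod (of (B (2 * s) (((j:ℚ) + 1) * (2 * s))))) m]
    have hR : (0:ℚ) < ((m:ℚ) + 1) * (2 * s) := by positivity
    have key := MultGlue.reassoc_eq hB stub_betaReassoc hs hs hR
    rw [show s + s = 2 * s by ring] at key
    have e1 : (((2 * m + 1 : ℕ) : ℚ) + 1) * s = ((m:ℚ) + 1) * (2 * s) := by push_cast; ring
    have e2 : (((2 * m + 1 + 1 : ℕ) : ℚ) + 1) * s = s + ((m:ℚ) + 1) * (2 * s) := by
      push_cast; ring
    rw [e1, e2]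
    linear_combination (toFormalPeriod (of (B s s)) ^ (m + 1) *
      ∏ j ∈ range m, toFormalPeriod (of (B (2 * s) (((j:ℚ) + 1) * (2 * s))))) * key

/-- The constant identity of the doubling step:
`(2^(2s))^m · (m+1)^((m+1)(2s)−1) · 2^(2s−1) = (2m+2)^((2m+2)s−1)`. [folklore] -/
theorem doublingConst_eq (m : ℕ) (s : ℚ) :
    ((((1:ℕ):ℝ) + 1) ^ ((((1:ℕ):ℝ) + 1) * (s:ℝ))) ^ m *
        ((((m:ℝ) + 1) ^ (((m:ℝ) + 1) * (((2 * s : ℚ)) : ℝ) - 1)) *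
          ((((1:ℕ):ℝ) + 1) ^ ((((1:ℕ):ℝ) + 1) * s - 1))) =
      (((2 * m + 1 : ℕ):ℝ) + 1) ^ ((((2 * m + 1 : ℕ):ℝ) + 1) * s - 1) := by
  have h2 : (0:ℝ) < 2 := two_pos
  have hM : (0:ℝ) < (m:ℝ) + 1 := by positivity
  have e0 : (((1:ℕ):ℝ) + 1) = 2 := by norm_num
  rw [e0, ← Real.rpow_mul_natCast h2.le]
  have e1 : (((2 * m + 1 : ℕ):ℝ) + 1) = 2 * ((m:ℝ) + 1) := by push_cast; ring
  rw [e1, Real.mul_rpow h2.le hM.le]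
  have e2 : (2:ℝ) ^ (2 * (s:ℝ) * (m:ℕ)) * (2:ℝ) ^ (2 * (s:ℝ) - 1) =
      (2:ℝ) ^ (2 * ((m:ℝ) + 1) * (s:ℝ) - 1) := by
    rw [← Real.rpow_add h2]
    congr 1
    ring
  have e3 : ((m:ℝ) + 1) * (((2 * s : ℚ)) : ℝ) - 1 = 2 * ((m:ℝ) + 1) * (s:ℝ) - 1 := by
    push_cast; ring
  rw [e3, ← e2]
  ring

/-- **The doubling step in `P`**: the identity of `At m (2s)` gives the identity of `At (2m+1) s`.
Pair `k ↔ k + (m+1)` in `∏_(k=1)^(2m+1) g(k/(2m+2), s)` (`Finset.prod_range_add`), apply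
duplication to every pair (`dup_eq`) and the instance `n = 2` to the middle factor `g(½, s)`
(`half_eq`), then the hypothesis and the caterpillar. [cite: AndrewsAskeyRoy1999, Thm 1.5.2] -/
theorem doubling_prod_eq {B : ℚ → ℚ → IntegralRep 1}
    (hB : ∀ p q, 0 < p → 0 < q → (B p q).domain = {t | t 0 ∈ Set.Ioo (0:ℝ) 1} ∧
      (B p q).integrand = fun t => (t 0) ^ ((p:ℝ) - 1) * (1 - t 0) ^ ((q:ℝ) - 1))
    (m : ℕ) {s : ℚ} (hs : 0 < s)
    (h : ∏ i ∈ range m, toFormalPeriod (of (B (((i:ℚ) + 1) / ((m:ℚ) + 1)) (2 * s))) =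
      toFormalPeriod (of (IntegralRep.unit.constMul
        (((m:ℝ) + 1) ^ (((m:ℝ) + 1) * (((2 * s : ℚ)) : ℝ) - 1))
        (isAlgebraic_gaussMultConst m (2 * s)))) *
        ∏ j ∈ range m, toFormalPeriod (of (B (2 * s) (((j:ℚ) + 1) * (2 * s))))) :
    ∏ i ∈ range (2 * m + 1),
        toFormalPeriod (of (B (((i:ℚ) + 1) / (((2 * m + 1 : ℕ):ℚ) + 1)) s)) =
      toFormalPeriod (of (IntegralRep.unit.constMul
        ((((2 * m + 1 : ℕ):ℝ) + 1) ^ ((((2 * m + 1 : ℕ):ℝ) + 1) * s - 1))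
        (isAlgebraic_gaussMultConst (2 * m + 1) s))) *
        ∏ j ∈ range (2 * m + 1), toFormalPeriod (of (B s (((j:ℚ) + 1) * s))) := by
  -- notation-free abbreviations
  set F : ℕ → FormalPeriodRing :=
    fun i => toFormalPeriod (of (B (((i:ℚ) + 1) / (((2 * m + 1 : ℕ):ℚ) + 1)) s)) with hF
  set gss := toFormalPeriod (of (B s s)) with hgss
  set c4 := toFormalPeriod (of (IntegralRep.unit.constMul
    ((((1:ℕ):ℝ) + 1) ^ ((((1:ℕ):ℝ) + 1) * (s:ℝ))) (MultGlue.isAlgebraic_gaussConst 1 s))) with hc4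
  set c2 := toFormalPeriod (of (IntegralRep.unit.constMul
    ((((1:ℕ):ℝ) + 1) ^ ((((1:ℕ):ℝ) + 1) * s - 1)) (isAlgebraic_gaussMultConst 1 s))) with hc2
  set cm := toFormalPeriod (of (IntegralRep.unit.constMul
    (((m:ℝ) + 1) ^ (((m:ℝ) + 1) * (((2 * s : ℚ)) : ℝ) - 1))
    (isAlgebraic_gaussMultConst m (2 * s)))) with hcm
  -- (A) split the left-hand side into pairs and the middle factor
  have hsplit : ∏ i ∈ range (2 * m + 1), F i = (∏ i ∈ range m, (F i * F (m + 1 + i))) * F m := by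
    rw [show 2 * m + 1 = m + 1 + m by ring, prod_range_add, prod_range_succ, prod_mul_distrib]
    ring
  -- (B) duplication on every pair
  have hpair : ∀ i ∈ range m, F i * F (m + 1 + i) =
      c4 * (toFormalPeriod (of (B (((i:ℚ) + 1) / ((m:ℚ) + 1)) (2 * s))) * gss) := by
    intro i _
    have hxpos : (0:ℚ) < ((i:ℚ) + 1) / (((2 * m + 1 : ℕ):ℚ) + 1) := by positivity
    have hx : (((m + 1 + i : ℕ):ℚ) + 1) / (((2 * m + 1 : ℕ):ℚ) + 1) =
        ((i:ℚ) + 1) / (((2 * m + 1 : ℕ):ℚ) + 1) + 1 / 2 := by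
      push_cast; field_simp; ring
    have h2x : 2 * (((i:ℚ) + 1) / (((2 * m + 1 : ℕ):ℚ) + 1)) = ((i:ℚ) + 1) / ((m:ℚ) + 1) := by
      push_cast; field_simp; ring
    simp only [hF]
    rw [hx, dup_eq hB hxpos hs, h2x]
  -- (C) the middle factor is `g(½, s)`
  have hmid : F m = c2 * gss := by
    have e : ((m:ℚ) + 1) / (((2 * m + 1 : ℕ):ℚ) + 1) = 1 / 2 := by
      push_cast; field_simp; ring
    simp only [hF]
    rw [e, half_eq hB hs]
  -- (D) assemble
  rw [hsplit, prod_congr rfl hpair, hmid, prod_mul_distrib, prod_mul_distrib, prod_const,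
    prod_const, card_range, h]
  have hcat := caterpillar_eq hB hs m
  -- (E) the constants
  have hconst : c4 ^ m * (cm * c2) = toFormalPeriod (of (IntegralRep.unit.constMul
      ((((2 * m + 1 : ℕ):ℝ) + 1) ^ ((((2 * m + 1 : ℕ):ℝ) + 1) * s - 1))
      (isAlgebraic_gaussMultConst (2 * m + 1) s))) := by
    have a4 := MultGlue.isAlgebraic_gaussConst 1 s
    have am := isAlgebraic_gaussMultConst m (2 * s)
    have a2 := isAlgebraic_gaussMultConst 1 s
    rw [hc4, hcm, hc2, ← MultGlue.ptConst_pow a4 m (a4.pow m), ← MultGlue.ptConst_mul am a2 (am.mul a2),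
      ← MultGlue.ptConst_mul (a4.pow m) (am.mul a2) ((a4.pow m).mul (am.mul a2))]
    exact MultGlue.ptConst_congr _ _ (doublingConst_eq m s)
  rw [← hcat, ← hconst]
  ring

end Doubling

open Summit.KontsevichZagierPeriods.MultiplicationAccessible.Negative (boxFun simplexDom simplexFun)

/-- **The doubling step**: the crux instance at `(m, 2s)` gives the crux instance at `(2m+1, s)`
(`n ↦ 2n`), for every rational `s > 0` — `Doubling.doubling_prod_eq` read back through
`Doubling.at_iff_prod_range_eq`; uses only the landed duplication (`gm_one`), the landed instance
`n = 2`, and Dirichlet re-association. [cite: AndrewsAskeyRoy1999, Thm 1.5.2] -/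
theorem at_doubling (m : ℕ) {s : ℚ} (hs : 0 < s) (h : At m (2 * s)) : At (2 * m + 1) s := by
  obtain ⟨B, hB⟩ := MultGlue.exists_betaFamily
  exact (Doubling.at_iff_prod_range_eq hB (2 * m + 1) s hs).mpr
    (Doubling.doubling_prod_eq hB m hs ((Doubling.at_iff_prod_range_eq hB m (2 * s) (by positivity)).mp h))

/-- Iterated doubling: the crux instances at `m₀` (all `s`) give the instances at every `m` with
`m + 1 = 2^k (m₀ + 1)`. [cite: AndrewsAskeyRoy1999, Thm 1.5.2] -/
theorem at_two_pow_mul (m₀ : ℕ) (h : ∀ s : ℚ, 0 < s → At m₀ s) :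
    ∀ (k m : ℕ), m + 1 = 2 ^ k * (m₀ + 1) → ∀ s : ℚ, 0 < s → At m s := by
  intro k
  induction k with
  | zero =>
    intro m hm s hs
    have : m = m₀ := by simpa using hm
    subst this
    exact h s hs
  | succ k ih =>
    intro m hm s hs
    obtain ⟨m₁, hm₁⟩ : ∃ m₁, m₁ + 1 = 2 ^ k * (m₀ + 1) :=
      ⟨2 ^ k * (m₀ + 1) - 1, Nat.sub_add_cancel (Nat.one_le_iff_ne_zero.mpr (by positivity))⟩
    have hm' : 2 * m₁ + 1 = m := by
      have : m + 1 = 2 * (m₁ + 1) := by rw [hm, hm₁, pow_succ]; ring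
      omega
    rw [← hm']
    exact at_doubling m₁ hs (ih m₁ hm₁ (2 * s) (by positivity))

/-- **`MultiplicationThree` is the instance `m = 2` of the crux** (the box integrand
`x₀^(−2/3)(1−x₀)^(s−1)x₁^(−1/3)(1−x₁)^(s−1)` and the simplex `{σ₁,σ₂>0, σ₁+σ₂<3}` with
`(σ₁σ₂(3−σ₁−σ₂))^(s−1)` are `boxFun 2 s` / `simplexDom 2` / `simplexFun 2 s` written out), so the
landed `MultiplicationThree_proof` gives `At 2 s` for every rational `s > 0`.
Adapted from `Cruxes/MultiplicationAccessible/Disproof.lean` §9 (`multiplicationThree_iff_at_two`).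
[folklore] -/
theorem at_two {s : ℚ} (hs : 0 < s) : At 2 s := by
  intro r r' hr hr'
  have hbox : ∀ x : Fin 2 → ℝ, boxFun 2 s x = (x 0) ^ (-(2:ℝ)/3) * (1 - x 0) ^ ((s:ℝ) - 1) *
      (x 1) ^ (-(1:ℝ)/3) * (1 - x 1) ^ ((s:ℝ) - 1) := fun x => by
    simp only [boxFun, Fin.prod_univ_two, Fin.val_zero, Fin.val_one, Nat.cast_zero, Nat.cast_one,
      Nat.cast_ofNat]
    have h0 : ((0:ℝ) + 1) / (2 + 1) - 1 = -(2:ℝ)/3 := by norm_num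
    have h1 : ((1:ℝ) + 1) / (2 + 1) - 1 = -(1:ℝ)/3 := by norm_num
    rw [h0, h1]
    ring
  have hdom : simplexDom 2 = {x : Fin 2 → ℝ | 0 < x 0 ∧ 0 < x 1 ∧ x 0 + x 1 < 3} := by
    ext x
    simp only [simplexDom, mem_setOf_eq, Fin.forall_fin_two, Fin.sum_univ_two, Nat.cast_ofNat]
    constructor
    · rintro ⟨⟨h0, h1⟩, h⟩
      exact ⟨h0, h1, by linarith⟩
    · rintro ⟨h0, h1, h⟩
      exact ⟨⟨h0, h1⟩, by linarith⟩
  have hspx : ∀ x : Fin 2 → ℝ, simplexFun 2 s x = (x 0 * x 1 * (3 - x 0 - x 1)) ^ ((s:ℝ) - 1) :=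
    fun x => by
      simp only [simplexFun, Fin.prod_univ_two, Fin.sum_univ_two, Nat.cast_ofNat]
      congr 1
      ring
  refine MultiplicationThreeBolza.MultiplicationThree_proof s hs r r' hr.1 (fun x hx => ?_)
    (hr'.1.trans hdom) (fun x hx => ?_)
  · rw [hr.2 hx, hbox]
  · rw [hr'.2 hx, hspx]

/-- The crux instance at every `m` with `m + 1 = 3·2^k` and every rational `s > 0`
(`at_two_pow_mul` from `at_two`). [cite: AndrewsAskeyRoy1999, Thm 1.5.2] -/
theorem at_three_mul_two_pow : ∀ (k m : ℕ), m + 1 = 3 * 2 ^ k → ∀ s : ℚ, 0 < s → At m s :=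
  fun k m hm => at_two_pow_mul 2 (fun _ hs => at_two hs) k m (by rw [hm]; ring)

/-- **Gauss multiplication inside the Kontsevich–Zagier rules at every `n = 3·2^k`**: for every `m`
with `m + 1 = 3·2^k` and every rational `s > 0`, the box representation of `∏_(i=1)^m B(i/n, s)`
and the big simplex representation of `n^(ns−1)Γ(s)^n/Γ(ns)` are equivalent — the instances
`n = 6, 12, 24, …` of the crux `MultiplicationAccessible` (and again `n = 3`), with no unproved
input: the landed `MultiplicationThree` doubled `k` times. [cite: AndrewsAskeyRoy1999, Thm 1.5.2] -/
theorem multiplicationAccessible_at_three_mul_two_pow :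
    ∀ (k m : ℕ), m + 1 = 3 * 2 ^ k → ∀ (s : ℚ), 0 < s → ∀ (r r' : KZ.IntegralRep m),
      r.domain = {x | ∀ i, x i ∈ Set.Ioo (0:ℝ) 1} →
      Set.EqOn r.integrand (fun x => ∏ i : Fin m,
        (x i) ^ ((((i:ℕ):ℝ) + 1) / ((m:ℝ) + 1) - 1) * (1 - x i) ^ ((s:ℝ) - 1)) r.domain →
      r'.domain = {x | (∀ i, 0 < x i) ∧ ∑ i, x i < (m:ℝ) + 1} →
      Set.EqOn r'.integrand
        (fun x => ((∏ i, x i) * ((m:ℝ) + 1 - ∑ i, x i)) ^ ((s:ℝ) - 1)) r'.domain →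
      KZ.Equivalent r r' :=
  fun k m hm s hs r r' hd hi hd' hi' => at_three_mul_two_pow k m hm s hs r r' ⟨hd, hi⟩ ⟨hd', hi'⟩

end Summit.KontsevichZagierPeriods.TerasomaMultiplication.MultiplicationAccessible

end
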